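import Literature.Analysis.FluidPDE.ParticleTrajectoryGradientBounds
import Summits.AnomalousDissipation.AnomalousDissipation.Theorems.SolenoidalFractalHomogenisationLagrangianCarrierConstructionFlowSmooth
import Summits.AnomalousDissipation.AnomalousDissipation.Theorems.SolenoidalFractalHomogenisationLagrangianCarrierConstructionRegularLNearIdentity
import HarnessLib

/-!
# K3L `LagrangianCarrierConstruction` (stmt-AnomalousDissipation-24913), line `birth`, stub `stub_regularL`: first- and second-order
# gradient bounds for the evolution maps of a field that is smooth only on ONE-SIDED time slabs (helper; `--supports stmt-AnomalousDissipation-24913`)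

Summits-side helper file (everything proved; no definitions, no named facts). The Eulerian lattice levels of the carrier are smooth in
space but only piecewise affine in time (trapezoidal slot envelopes), so the a priori flow-map estimates of
`Literature.Analysis.FluidPDE.ParticleTrajectoryGradientBounds` — `‖∇φ(s→t) − I‖ ≤ e^{M|t−s|} − 1` and
`‖∇φ(s→t)(z) − ∇φ(s→t)(z')‖ ≤ L|t−s|e^{3M|t−s|}‖z − z'‖` for a JOINTLY smooth field with `‖∇u‖ ≤ M`, `‖∇²u‖ ≤ L`
(Buckmaster–De Lellis–Székelyhidi–Vicol App. B (B.4)–(B.5); Armstrong–Vicol Prop. 2.2) — apply only slab by slab. This file chains them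
across the break times: `forall_le_of_chain_local` (an ordered-pair variant of `…FlowSmooth.forall_of_chain_local`: a relation on ordered
pairs that is reflexive, concatenates at intermediate times and holds locally on one-sided neighbourhoods holds for all ordered pairs),
the concatenation algebra being `…RegularLNearIdentity` (`e^{a} e^{b} = e^{a+b}`, `L τ₁ e^{3Mτ₁} e^{2Mτ₂} + e^{Mτ₁} L τ₂ e^{3Mτ₂} ≤
L(τ₁+τ₂)e^{3M(τ₁+τ₂)}`); result `norm_fderiv_evolutionMap_bounds_of_local`, for ALL pairs of times in either order. Infrastructure for
route-1's rung leaf F-D1.A0 (a frontier FORMAL rung); NOT a proof of anomalous dissipation.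
-/

set_option linter.dupNamespace false

noncomputable section

namespace Summit.AnomalousDissipation.AnomalousDissipation.Theorems.SolenoidalFractalHomogenisation.LagrangianCarrierConstruction

open Set Function Filter Topology Metric
open scoped NNReal ContDiff
open Literature.Analysis.ODE Literature.Analysis.FluidPDE

/-! ## Chaining a relation on ordered pairs of times -/

/-- **Chaining along the line, ordered pairs.** A relation `Q a b` on pairs `a ≤ b` which is reflexive, concatenates
(`Q a b → Q b c → Q a c` for `a ≤ b ≤ c`) and holds for all ordered pairs inside `[r, r+ε_r]` and inside `[r−ε_r, r]` around every `r`
holds for every ordered pair (via `forall_of_chain_local` applied to "Q on all ordered sub-pairs of `[s, t]`"). [folklore] -/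
theorem forall_le_of_chain_local {Q : ℝ → ℝ → Prop} (hrefl : ∀ s, Q s s)
    (hconcat : ∀ a b c, a ≤ b → b ≤ c → Q a b → Q b c → Q a c)
    (hloc : ∀ r, ∃ ε > 0, (∀ a b, r ≤ a → a ≤ b → b ≤ r + ε → Q a b) ∧ (∀ a b, r - ε ≤ a → a ≤ b → b ≤ r → Q a b)) :
    ∀ a b, a ≤ b → Q a b := by
  have key : ∀ s t : ℝ, s ≤ t → ∀ a b, s ≤ a → a ≤ b → b ≤ t → Q a b := by
    refine forall_of_chain_local (P := fun s t => s ≤ t → ∀ a b, s ≤ a → a ≤ b → b ≤ t → Q a b) ?_ ?_ ?_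
    · intro s _ a b hsa hab hbs
      have ha : a = s := le_antisymm (hab.trans hbs) hsa
      have hb : b = s := le_antisymm hbs (hsa.trans hab)
      rw [ha, hb]; exact hrefl s
    · intro r s t hrs hst hrt a b hra hab hbt
      rcases le_total b s with hbs | hsb
      · exact hrs (hra.trans (hab.trans hbs)) a b hra hab hbs
      · rcases le_total s a with hsa | has
        · exact hst (hsa.trans (hab.trans hbt)) a b hsa hab hbt
        · exact hconcat a s b has hsb (hrs (hra.trans has) a s hra has le_rfl) (hst (hsb.trans hbt) s b le_rfl hsb hbt)
    · intro r
      obtain ⟨ε, hε, hR, hL⟩ := hloc r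
      refine ⟨ε, hε, fun t ht => ⟨fun hrt a b hra hab hbt => ?_, fun htr a b hta hab hbr => ?_⟩⟩
      · rw [Real.dist_eq, abs_lt] at ht
        exact hR a b hra hab (by linarith)
      · rw [Real.dist_eq, abs_lt] at ht
        exact hL a b (by linarith) hab hbr
  exact fun a b hab => key a b hab a b le_rfl hab le_rfl

/-! ## Gradient bounds of evolution maps, chained across break times -/

section Evolution

variable {V : Type*} [NormedAddCommGroup V] [NormedSpace ℝ V] [CompleteSpace V]
variable {v : ℝ → V → V}

omit [CompleteSpace V] in
/-- The concatenation algebra: if `f`, `g` carry the bounds with time spans `τ₁`, `τ₂ ≥ 0`, then `f ∘ g` carries them with `τ₁ + τ₂`.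
[cite: BuckmasterEtAl2018, App. B Prop. B.1 (B.4)–(B.5)] -/
theorem fderiv_comp_bounds_concat {f g : V → V} (hf : Differentiable ℝ f) (hg : Differentiable ℝ g) {M L τ₁ τ₂ : ℝ}
    (hM : 0 ≤ M) (hL : 0 ≤ L) (hτ₁ : 0 ≤ τ₁) (hτ₂ : 0 ≤ τ₂)
    (hδf : ∀ z, ‖fderiv ℝ f z - ContinuousLinearMap.id ℝ V‖ ≤ Real.exp (M * τ₁) - 1)
    (hδg : ∀ z, ‖fderiv ℝ g z - ContinuousLinearMap.id ℝ V‖ ≤ Real.exp (M * τ₂) - 1)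
    (hβf : ∀ z z', ‖fderiv ℝ f z - fderiv ℝ f z'‖ ≤ L * τ₁ * Real.exp (3 * M * τ₁) * ‖z - z'‖)
    (hβg : ∀ z z', ‖fderiv ℝ g z - fderiv ℝ g z'‖ ≤ L * τ₂ * Real.exp (3 * M * τ₂) * ‖z - z'‖) :
    (∀ z, ‖fderiv ℝ (f ∘ g) z - ContinuousLinearMap.id ℝ V‖ ≤ Real.exp (M * (τ₁ + τ₂)) - 1) ∧
    (∀ z z', ‖fderiv ℝ (f ∘ g) z - fderiv ℝ (f ∘ g) z'‖ ≤
      L * (τ₁ + τ₂) * Real.exp (3 * M * (τ₁ + τ₂)) * ‖z - z'‖) := by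
  constructor
  · intro z
    refine (norm_fderiv_comp_sub_id_le hf hg hδf hδg z).trans (le_of_eq ?_)
    rw [mul_add, Real.exp_add]; ring
  · intro z z'
    have hβf0 : 0 ≤ L * τ₁ * Real.exp (3 * M * τ₁) := by positivity
    refine (norm_fderiv_comp_sub_fderiv_comp_le hf hg hβf0 hδf hδg hβf hβg z z').trans ?_
    refine mul_le_mul_of_nonneg_right ?_ (norm_nonneg _)
    have h1 : (1 + (Real.exp (M * τ₂) - 1)) ^ 2 = Real.exp (2 * M * τ₂) := by
      rw [add_sub_cancel, ← Real.exp_nat_mul]; ring_nf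
    have h2 : 1 + (Real.exp (M * τ₁) - 1) = Real.exp (M * τ₁) := by ring
    rw [h1, h2]
    have e1 : Real.exp (3 * M * τ₁) * Real.exp (2 * M * τ₂) ≤ Real.exp (3 * M * (τ₁ + τ₂)) := by
      rw [← Real.exp_add]; exact Real.exp_le_exp.2 (by nlinarith)
    have e2 : Real.exp (M * τ₁) * Real.exp (3 * M * τ₂) ≤ Real.exp (3 * M * (τ₁ + τ₂)) := by
      rw [← Real.exp_add]; exact Real.exp_le_exp.2 (by nlinarith)
    calc L * τ₁ * Real.exp (3 * M * τ₁) * Real.exp (2 * M * τ₂) + Real.exp (M * τ₁) * (L * τ₂ * Real.exp (3 * M * τ₂))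
        = L * τ₁ * (Real.exp (3 * M * τ₁) * Real.exp (2 * M * τ₂)) + L * τ₂ * (Real.exp (M * τ₁) * Real.exp (3 * M * τ₂)) := by
          ring
      _ ≤ L * τ₁ * Real.exp (3 * M * (τ₁ + τ₂)) + L * τ₂ * Real.exp (3 * M * (τ₁ + τ₂)) := by
          gcongr
      _ = L * (τ₁ + τ₂) * Real.exp (3 * M * (τ₁ + τ₂)) := by ring

/-- **Gradient bounds of the evolution maps of a field smooth on one-sided time slabs.** If `v` satisfies the Cauchy–Lipschitz hypotheses
on `ℝ`, is `C^∞` on the slabs `[r, r+ε] × V`, `[r−ε, r] × V` around every `r`, and `‖∇v(t)‖ ≤ M`, `‖∇²v(t)‖ ≤ L` everywhere, then for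
ALL `s, t` (either order) and all `z, z'`:
`‖∇φ(s→t)(z) − I‖ ≤ e^{M|t−s|} − 1` and `‖∇φ(s→t)(z) − ∇φ(s→t)(z')‖ ≤ L |t−s| e^{3M|t−s|} ‖z − z'‖`.
[cite: BuckmasterEtAl2018, App. B Prop. B.1 (B.4)–(B.5)] [cite: ArmstrongVicol2025, Prop. 2.2 (p. 19)] -/
theorem norm_fderiv_evolutionMap_bounds_of_local (hv : IsUniformlyLipschitzOn v univ)
    (hloc : ∀ r : ℝ, ∃ ε > 0, ContDiffOn ℝ ∞ (uncurry v) (Icc r (r + ε) ×ˢ univ) ∧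
      ContDiffOn ℝ ∞ (uncurry v) (Icc (r - ε) r ×ˢ univ))
    {M L : ℝ} (hM : ∀ t y, ‖fderiv ℝ (v t) y‖ ≤ M) (hL : ∀ t y, ‖iteratedFDeriv ℝ 2 (v t) y‖ ≤ L) (s t : ℝ) :
    (∀ z, ‖fderiv ℝ (evolutionMap v s t) z - ContinuousLinearMap.id ℝ V‖ ≤ Real.exp (M * |t - s|) - 1) ∧
    (∀ z z', ‖fderiv ℝ (evolutionMap v s t) z - fderiv ℝ (evolutionMap v s t) z'‖ ≤
      L * |t - s| * Real.exp (3 * M * |t - s|) * ‖z - z'‖) := by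
  have hM0 : 0 ≤ M := (norm_nonneg _).trans (hM 0 0)
  have hL0 : 0 ≤ L := (norm_nonneg _).trans (hL 0 0)
  have hloc1 : ∀ r : ℝ, ∃ ε > 0, ContDiffOn ℝ 1 (uncurry v) (Icc r (r + ε) ×ˢ univ) ∧
      ContDiffOn ℝ 1 (uncurry v) (Icc (r - ε) r ×ˢ univ) := fun r => by
    obtain ⟨ε, hε, h1, h2⟩ := hloc r
    exact ⟨ε, hε, h1.of_le (by exact_mod_cast le_top), h2.of_le (by exact_mod_cast le_top)⟩
  have hd : ∀ a b, Differentiable ℝ (evolutionMap v a b) := fun a b =>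
    (contDiff_evolutionMap_of_local hv le_rfl hloc1 a b).differentiable (by simp)
  -- the two-sided relation on a pair `(a, b)`: bounds for `φ(a→b)` (span `b − a`) and for `φ(b→a)`
  set Q : ℝ → ℝ → Prop := fun a b =>
    ((∀ z, ‖fderiv ℝ (evolutionMap v a b) z - ContinuousLinearMap.id ℝ V‖ ≤ Real.exp (M * (b - a)) - 1) ∧
      (∀ z z', ‖fderiv ℝ (evolutionMap v a b) z - fderiv ℝ (evolutionMap v a b) z'‖ ≤
        L * (b - a) * Real.exp (3 * M * (b - a)) * ‖z - z'‖)) ∧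
    ((∀ z, ‖fderiv ℝ (evolutionMap v b a) z - ContinuousLinearMap.id ℝ V‖ ≤ Real.exp (M * (b - a)) - 1) ∧
      (∀ z z', ‖fderiv ℝ (evolutionMap v b a) z - fderiv ℝ (evolutionMap v b a) z'‖ ≤
        L * (b - a) * Real.exp (3 * M * (b - a)) * ‖z - z'‖)) with hQ
  -- bounds on a slab where the field is jointly smooth, for any two times of the slab
  have slab : ∀ S : Set ℝ, Convex ℝ S → UniqueDiffOn ℝ S → ContDiffOn ℝ ∞ (uncurry v) (S ×ˢ univ) →
      ∀ a ∈ S, ∀ b ∈ S,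
      (∀ z, ‖fderiv ℝ (evolutionMap v a b) z - ContinuousLinearMap.id ℝ V‖ ≤ Real.exp (M * |b - a|) - 1) ∧
      (∀ z z', ‖fderiv ℝ (evolutionMap v a b) z - fderiv ℝ (evolutionMap v a b) z'‖ ≤
        L * |b - a| * Real.exp (3 * M * |b - a|) * ‖z - z'‖) := by
    intro S hS hSu hvS a ha b hb
    have hu : IsSmoothSpaceTimeOn S v := hvS
    exact ⟨fun z => norm_fderiv_evolutionMap_sub_id_le (hv.mono (subset_univ S)) hu hS hSu ha hb (fun s _ y => hM s y) z,
      fun z z' => norm_fderiv_evolutionMap_sub_fderiv_le' (hv.mono (subset_univ S)) hu hS hSu ha hb (fun s _ y => hM s y)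
        (fun s _ y => hL s y) z z'⟩
  have slabQ : ∀ S : Set ℝ, Convex ℝ S → UniqueDiffOn ℝ S → ContDiffOn ℝ ∞ (uncurry v) (S ×ˢ univ) →
      ∀ a ∈ S, ∀ b ∈ S, a ≤ b → Q a b := by
    intro S hS hSu hvS a ha b hb hab
    have h1 := slab S hS hSu hvS a ha b hb
    have h2 := slab S hS hSu hvS b hb a ha
    rw [abs_of_nonneg (sub_nonneg.2 hab)] at h1
    rw [abs_sub_comm, abs_of_nonneg (sub_nonneg.2 hab)] at h2
    exact ⟨h1, h2⟩
  have main : ∀ a b, a ≤ b → Q a b := by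
    refine forall_le_of_chain_local ?_ ?_ ?_
    · -- reflexivity: `φ(s→s) = id`
      intro s
      have e : evolutionMap v s s = id := funext fun x => evolutionMap_self v s x
      have h0 : ∀ z, ‖fderiv ℝ (evolutionMap v s s) z - ContinuousLinearMap.id ℝ V‖ ≤ Real.exp (M * (s - s)) - 1 := fun z => by
        rw [e]; simp
      have h0' : ∀ z z', ‖fderiv ℝ (evolutionMap v s s) z - fderiv ℝ (evolutionMap v s s) z'‖ ≤
          L * (s - s) * Real.exp (3 * M * (s - s)) * ‖z - z'‖ := fun z z' => by
        rw [e]; simp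
      exact ⟨⟨h0, h0'⟩, ⟨h0, h0'⟩⟩
    · -- concatenation at an intermediate time
      intro a b c hab hbc hQab hQbc
      obtain ⟨⟨h1, h1'⟩, ⟨h2, h2'⟩⟩ := hQab
      obtain ⟨⟨h3, h3'⟩, ⟨h4, h4'⟩⟩ := hQbc
      have eF : evolutionMap v a c = evolutionMap v b c ∘ evolutionMap v a b :=
        funext fun z => (evolutionMap_trans_univ hv a b c z).symm
      have eB : evolutionMap v c a = evolutionMap v b a ∘ evolutionMap v c b :=
        funext fun z => (evolutionMap_trans_univ hv c b a z).symm
      have hca : c - a = (c - b) + (b - a) := by ring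
      have hca' : c - a = (b - a) + (c - b) := by ring
      refine ⟨?_, ?_⟩
      · rw [eF, hca]
        exact fderiv_comp_bounds_concat (hd b c) (hd a b) hM0 hL0 (sub_nonneg.2 hbc) (sub_nonneg.2 hab) h3 h1 h3' h1'
      · rw [eB, hca']
        exact fderiv_comp_bounds_concat (hd b a) (hd c b) hM0 hL0 (sub_nonneg.2 hab) (sub_nonneg.2 hbc) h2 h4 h2' h4'
    · -- locally, on the one-sided smooth slabs
      intro r
      obtain ⟨ε, hε, hR, hL'⟩ := hloc r
      refine ⟨ε, hε, fun a b hra hab hbr => ?_, fun a b hra hab hbr => ?_⟩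
      · exact slabQ _ (convex_Icc _ _) (uniqueDiffOn_Icc (by linarith)) hR a ⟨hra, hab.trans hbr⟩ b ⟨hra.trans hab, hbr⟩ hab
      · exact slabQ _ (convex_Icc _ _) (uniqueDiffOn_Icc (by linarith)) hL' a ⟨hra, hab.trans hbr⟩ b ⟨hra.trans hab, hbr⟩ hab
  rcases le_total s t with hst | hts
  · have h := (main s t hst).1
    rwa [abs_of_nonneg (sub_nonneg.2 hst)]
  · have h := (main t s hts).2
    rwa [abs_sub_comm, abs_of_nonneg (sub_nonneg.2 hts)]

/-- Companion sup bound on the displacement: `‖φ(s→t)(z) − z‖ ≤ U |t − s|` when `‖v‖ ≤ U` (restated on all of `ℝ`).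
[cite: MajdaBertozziCUP2002, §4.2 eq. (4.46)] -/
theorem norm_evolutionMap_sub_self_le_univ (hv : IsUniformlyLipschitzOn v univ) {U : ℝ} (hU : ∀ t y, ‖v t y‖ ≤ U)
    (s t : ℝ) (z : V) : ‖evolutionMap v s t z - z‖ ≤ U * |t - s| :=
  norm_evolutionMap_sub_self_le hv convex_univ (mem_univ s) (mem_univ t) (fun r _ y => hU r y) z

end Evolution

end Summit.AnomalousDissipation.AnomalousDissipation.Theorems.SolenoidalFractalHomogenisation.LagrangianCarrierConstruction

end
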